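import Summits.RiemannHypothesis.RiemannHypothesis.Theorems.PfPersistenceMarkovCoreDensity
import HarnessLib

/-!
# PF persistence (theory 1, edge law): THE MARKOV CORE OF A NON-NEGATIVE WEIGHT TABLE, VI —
# EXISTENCE of a core ground state for every non-negative table at every window

Helper file (`--supports stmt-RiemannHypothesis-19953`); mechanism/rigidity campaign; no RH claims.
For EVERY weight table `w` with `w n ≥ 0` on the prime index and EVERY window `a > 0` (objects in
`PfPersistenceMarkovCore`):

* `table_finiteEnergy_of_tendsto` — lower semicontinuity of `𝓔^w_a` along `L²`-convergent sequences
  of window test functions (Fatou in the jump length);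
* `weilDirichletEnergy_le_of_table` — `𝓔_a(g) ≤ 4(Σ_{index} Λ(n)/√n)‖g‖² + 𝓔^w_a(g)`: a
  `𝓔^w_a`-bounded sequence of normalised window tests has `Re Q_ζ` bounded, so the
  Connes–Consani–Moscovici compactness (the tree's THEOREM `ConnesConsaniMoscovici2025_thm_3_6_holds`)
  applies to it;
* `exists_isCoreGround` — a CORE GROUND STATE EXISTS: `∃ u, IsCoreGround w a u`;
* `coreBottom_eq_sInf_isWeilTest` — the core bottom is the infimum of `𝓔^w_a` over normalised
  window test functions (window tests are a form core, `PfPersistenceMarkovCoreDensity`);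
* `coreForm_eq_re_quadratic_sub` — DICTIONARY to the campaign's continuum datum: on window test
  functions `coreForm a w g = Re Q_{tableDatum w}(g) − weilPoleForm g` (the core is the pole-free part of
  the datum's windowed form; ζ: `coreForm_zetaTable_eq`).

Together with `PfPersistenceMarkovCorePerronFrobenius` (simplicity, positivity, evenness, phase):
the Markov core of every non-negative table has, at every window, a unique-up-to-phase ground state,
which is `γΦ` with `Φ` even and strictly positive on the open window — kernel Perron–Frobenius in
full, RH-free and operator-free; in the cell's language channels (I) and (M) are empty for the whole
class, so they carry no information about ζ.

## References

* M. Fukushima, Y. Oshima, M. Takeda, *Dirichlet Forms and Symmetric Markov Processes*, 2nd ed.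
  (2011), §1.4 Example 1.4.1 (smooth compactly supported functions are a core of a translation
  invariant jump form).
* E. Bombieri, Rend. Mat. Acc. Lincei (9) 11 (2000) 183–233, §4 Thm 3 (minimising sequences; lower
  semicontinuity of the energy).
* A. Connes, C. Consani, H. Moscovici, *Zeta zeros and prolate wave operators: semilocal adelic
  operators* (2025), Thm 3.6 (compactness of bounded-form sequences on a window).
* M. Reed, B. Simon, *Methods of Modern Mathematical Physics IV* (1978), §XIII.12.
-/

set_option linter.dupNamespace false

noncomputable section

open MeasureTheory Set Filter
open scoped Topology ENNReal NNReal ComplexConjugate ArithmeticFunction.vonMangoldt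

namespace Summit.RiemannHypothesis.RiemannHypothesis.Theorems.PfPersistence

open Literature.NumberTheory.LFunctions Literature.NumberTheory.LFunctions.ConnesVanSuijlekom
open Summit.RiemannHypothesis.RiemannHypothesis.Theorems.WeilWindowFlowWindowLipschitz
open Summit.RiemannHypothesis.RiemannHypothesis.Theorems.WeilGroundStateMarkovPart
open Summit.RiemannHypothesis.RiemannHypothesis.Theorems.PfPersistenceDownCone (zetaTable tableDatum)

/-! ## Lower semicontinuity of the table energy along `L²`-convergent test sequences -/

/-- **Lower semicontinuity of `𝓔^w_a`** (Fatou in the jump length; the tree's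
`finiteEnergy_of_tendsto` for a table): if window test functions `gₙ → u ∈ L²` in `L²` and
`𝓔^w_a(gₙ) → L`, then `u` has finite archimedean energy and `𝓔^w_a(u) ≤ L` (the finitely many prime
increments converge; Fatou bounds the archimedean part). [cite: Bombieri2000Weil, §4 Thm 3] -/
theorem table_finiteEnergy_of_tendsto {a : ℝ} {w : ℕ → ℝ} {u : ℝ → ℂ} {g : ℕ → ℝ → ℂ}
    (hgt : ∀ n, IsWeilTest (g n)) (hu : MemLp u 2)
    (hL2 : Tendsto (fun n ↦ ∫ x, ‖g n x - u x‖ ^ 2) atTop (𝓝 0)) {L : ℝ}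
    (hE : Tendsto (fun n ↦ tableDirichletEnergy a w (g n)) atTop (𝓝 L)) :
    IntegrableOn (fun t ↦ weilArchDensity t * weilIncrement u t) (Ioi 0) ∧
      tableDirichletEnergy a w u ≤ L := by
  have hgm : ∀ n, MemLp (g n) 2 := fun n ↦ (hgt n).memLp_two
  have hD : ∀ t, Tendsto (fun n ↦ weilIncrement (g n) t) atTop (𝓝 (weilIncrement u t)) :=
    tendsto_weilIncrement_of_tendsto hu hgm hL2
  -- the prime parts converge
  set P : (ℝ → ℂ) → ℝ := fun f ↦ ∑ n ∈ weilPrimeIndex a, w n * weilIncrement f (Real.log n)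
    with hP
  have hprimes : Tendsto (fun k ↦ P (g k)) atTop (𝓝 (P u)) :=
    tendsto_finsetSum _ fun n _ ↦ (hD (Real.log n)).const_mul _
  -- hence the archimedean parts converge to `L - P u`
  have hA : Tendsto (fun k ↦ ∫ t in Ioi (0 : ℝ), weilArchDensity t * weilIncrement (g k) t)
      atTop (𝓝 (L - P u)) := by
    have e : (fun k ↦ ∫ t in Ioi (0 : ℝ), weilArchDensity t * weilIncrement (g k) t) =
        fun k ↦ tableDirichletEnergy a w (g k) - P (g k) := by
      funext k
      simp only [tableDirichletEnergy, hP]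
      ring
    rw [e]
    exact hE.sub hprimes
  -- Fatou
  have hFmeas : ∀ n, Measurable fun t ↦ weilArchDensity t * weilIncrement (g n) t := fun n ↦
    measurable_weilArchDensity.mul (continuous_weilIncrement (hgt n)).measurable
  have hFlim : ∀ t, Tendsto (fun n ↦ weilArchDensity t * weilIncrement (g n) t) atTop
      (𝓝 (weilArchDensity t * weilIncrement u t)) := fun t ↦ (hD t).const_mul _
  have hFu_meas : AEStronglyMeasurable (fun t ↦ weilArchDensity t * weilIncrement u t)
      (volume.restrict (Ioi 0)) :=
    aestronglyMeasurable_of_tendsto_ae atTop (fun n ↦ (hFmeas n).aestronglyMeasurable)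
      (Eventually.of_forall hFlim)
  have hF_nonneg : ∀ f : ℝ → ℂ,
      0 ≤ᵐ[volume.restrict (Ioi 0)] fun t ↦ weilArchDensity t * weilIncrement f t := fun f ↦
    (ae_restrict_iff' measurableSet_Ioi).2 (Eventually.of_forall fun t ht ↦
      mul_nonneg (weilArchDensity_pos ht).le (weilIncrement_nonneg f t))
  have hFint : ∀ n, IntegrableOn (fun t ↦ weilArchDensity t * weilIncrement (g n) t) (Ioi 0) :=
    fun n ↦ integrableOn_weilArchDensity_mul_weilIncrement (hgt n)
  have hL : 0 ≤ L - P u := ge_of_tendsto' hA fun n ↦ setIntegral_nonneg measurableSet_Ioi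
    fun t ht ↦ mul_nonneg (weilArchDensity_pos ht).le (weilIncrement_nonneg _ t)
  have hlint : ∫⁻ t in Ioi (0 : ℝ), ENNReal.ofReal (weilArchDensity t * weilIncrement u t) ≤
      ENNReal.ofReal (L - P u) := by
    have h1 : ∀ t, liminf (fun n ↦ ENNReal.ofReal (weilArchDensity t * weilIncrement (g n) t))
        atTop = ENNReal.ofReal (weilArchDensity t * weilIncrement u t) := fun t ↦
      (ENNReal.tendsto_ofReal (hFlim t)).liminf_eq
    have h2 : Tendsto (fun n ↦ ∫⁻ t in Ioi (0 : ℝ),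
        ENNReal.ofReal (weilArchDensity t * weilIncrement (g n) t)) atTop
        (𝓝 (ENNReal.ofReal (L - P u))) := by
      have h3 : ∀ n, ∫⁻ t in Ioi (0 : ℝ), ENNReal.ofReal (weilArchDensity t * weilIncrement (g n) t)
          = ENNReal.ofReal (∫ t in Ioi (0 : ℝ), weilArchDensity t * weilIncrement (g n) t) :=
        fun n ↦ (ofReal_integral_eq_lintegral_ofReal (hFint n) (hF_nonneg (g n))).symm
      simp only [h3]
      exact ENNReal.tendsto_ofReal hA
    calc ∫⁻ t in Ioi (0 : ℝ), ENNReal.ofReal (weilArchDensity t * weilIncrement u t)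
        = ∫⁻ t in Ioi (0 : ℝ), liminf (fun n ↦
            ENNReal.ofReal (weilArchDensity t * weilIncrement (g n) t)) atTop := by
          simp only [h1]
      _ ≤ liminf (fun n ↦ ∫⁻ t in Ioi (0 : ℝ),
            ENNReal.ofReal (weilArchDensity t * weilIncrement (g n) t)) atTop :=
          lintegral_liminf_le fun n ↦ (hFmeas n).ennreal_ofReal
      _ = ENNReal.ofReal (L - P u) := h2.liminf_eq
  have hint : IntegrableOn (fun t ↦ weilArchDensity t * weilIncrement u t) (Ioi 0) :=
    ⟨hFu_meas, (hasFiniteIntegral_iff_ofReal (hF_nonneg u)).2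
      (hlint.trans_lt ENNReal.ofReal_lt_top)⟩
  refine ⟨hint, ?_⟩
  have hle : ∫ t in Ioi (0 : ℝ), weilArchDensity t * weilIncrement u t ≤ L - P u := by
    rw [integral_eq_lintegral_of_nonneg_ae (hF_nonneg u) hFu_meas]
    exact ENNReal.toReal_le_of_le_ofReal hL hlint
  have hsplit : tableDirichletEnergy a w u = P u +
      ∫ t in Ioi (0 : ℝ), weilArchDensity t * weilIncrement u t := rfl
  linarith

/-! ## Existence of a core ground state for every non-negative table -/

/-- The energy of a window test function controls its archimedean energy and ζ's energy:
`∫ρD(g) ≤ 𝓔^w_a(g)` and `𝓔_a(g) ≤ 4 (Σ_{n ∈ index} Λ(n)/√n) ∫|g|² + 𝓔^w_a(g)` (`D_t(g) ≤ 4‖g‖²`).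
[folklore] -/
theorem weilDirichletEnergy_le_of_table {a : ℝ} {w : ℕ → ℝ} (hw : ∀ n ∈ weilPrimeIndex a, 0 ≤ w n)
    {g : ℝ → ℂ} (hg : MemLp g 2) :
    weilDirichletEnergy a g ≤
      4 * (∑ n ∈ weilPrimeIndex a, (Λ n : ℝ) / Real.sqrt n) * (∫ x, ‖g x‖ ^ 2) +
        tableDirichletEnergy a w g := by
  have harch : ∫ t in Ioi (0 : ℝ), weilArchDensity t * weilIncrement g t ≤
      tableDirichletEnergy a w g :=
    le_add_of_nonneg_left (Finset.sum_nonneg fun n hn ↦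
      mul_nonneg (hw n hn) (weilIncrement_nonneg g _))
  have hprime : (∑ n ∈ weilPrimeIndex a, (Λ n : ℝ) / Real.sqrt n * weilIncrement g (Real.log n)) ≤
      4 * (∑ n ∈ weilPrimeIndex a, (Λ n : ℝ) / Real.sqrt n) * ∫ x, ‖g x‖ ^ 2 := by
    rw [Finset.mul_sum, Finset.sum_mul]
    refine Finset.sum_le_sum fun n _ ↦ ?_
    have h4 := weilIncrement_le_four_mul_of_memLp hg (Real.log n)
    have hc : 0 ≤ (Λ n : ℝ) / Real.sqrt n :=
      div_nonneg ArithmeticFunction.vonMangoldt_nonneg (Real.sqrt_nonneg _)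
    nlinarith [h4, hc]
  unfold weilDirichletEnergy
  linarith

/-- **Existence of a core ground state for every non-negative table at every window, and the core
bottom is attained along window test functions.** For `a > 0` and `w ≥ 0` on the prime index:
`coreBottom w a = inf {𝓔^w_a(h) : h window test, ∫|h|² = 1}` and some `u` is a core ground state
(`IsCoreGround w a u`).  Proof: a `𝓔^w_a`-minimising sequence of normalised window tests has
`Re Q_ζ` bounded (`weilDirichletEnergy_le_of_table`, `weilPoleForm_le_of_sphere`), so the
Connes–Consani–Moscovici compactness `ConnesConsaniMoscovici2025_thm_3_6_holds` gives an
`L²`-convergent subsequence; lower semicontinuity (`table_finiteEnergy_of_tendsto`) and density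
(`table_bottom_mul_le_of_finiteEnergy`) identify the limit as a core ground state.
[cite: ConnesConsaniMoscovici2025, Thm 3.6] -/
theorem exists_isCoreGround_and_coreBottom_eq {a : ℝ} {w : ℕ → ℝ}
    (hw : ∀ n ∈ weilPrimeIndex a, 0 ≤ w n) (ha : 0 < a) :
    (∃ u : ℝ → ℂ, IsCoreGround w a u) ∧
      coreBottom w a = sInf {x : ℝ | ∃ h : ℝ → ℂ, IsWeilTest h ∧ tsupport h ⊆ Icc (-a) a ∧
        ∫ t, ‖h t‖ ^ 2 = (1 : ℝ) ∧ x = tableDirichletEnergy a w h} := by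
  set T : Set ℝ := {x : ℝ | ∃ h : ℝ → ℂ, IsWeilTest h ∧ tsupport h ⊆ Icc (-a) a ∧
    ∫ t, ‖h t‖ ^ 2 = (1 : ℝ) ∧ x = tableDirichletEnergy a w h} with hTdef
  have hTne : T.Nonempty := by
    obtain ⟨g, hg, hgs, hn⟩ := exists_isWeilTest_sphere ha
    exact ⟨_, g, hg, hgs, hn, rfl⟩
  have hTbdd : BddBelow T := by
    refine ⟨0, ?_⟩
    rintro _ ⟨h, -, -, -, rfl⟩
    exact tableDirichletEnergy_nonneg hw h
  set B : ℝ := sInf T with hBdef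
  -- `coreBottom ≤ B`: window tests lie in the finite-energy class
  have hcoreB : coreBottom w a ≤ B := by
    refine le_csInf hTne ?_
    rintro _ ⟨h, hh, hhs, hn, rfl⟩
    exact coreBottom_le hw (coreAdm_of_isWeilTest hh hhs) hn
  -- `B ∫|h|² ≤ 𝓔^w_a(h)` on window tests (normalise)
  have hBtest : ∀ h : ℝ → ℂ, IsWeilTest h → tsupport h ⊆ Icc (-a) a →
      B * ∫ x, ‖h x‖ ^ 2 ≤ tableDirichletEnergy a w h := by
    intro h hh hhs
    set N : ℝ := ∫ x, ‖h x‖ ^ 2 with hN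
    have hN0 : 0 ≤ N := integral_nonneg fun _ ↦ by positivity
    rcases hN0.eq_or_lt with hz | hpos
    · rw [← hz, mul_zero]
      exact tableDirichletEnergy_nonneg hw h
    set c : ℝ := (Real.sqrt N)⁻¹ with hc
    have hcpos : 0 < c := inv_pos.2 (Real.sqrt_pos.2 hpos)
    set h₁ : ℝ → ℂ := fun x ↦ (c : ℂ) * h x with hh₁
    have hh₁t : IsWeilTest h₁ := hh.const_mul c
    have hh₁s : tsupport h₁ ⊆ Icc (-a) a := tsupport_mul_subset_right.trans hhs
    have hc2 : ‖(c : ℂ)‖ ^ 2 = N⁻¹ := by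
      rw [Complex.norm_real, Real.norm_of_nonneg hcpos.le, hc, inv_pow, Real.sq_sqrt hN0]
    have hn₁ : ∫ x, ‖h₁ x‖ ^ 2 = 1 := by
      have e : (fun x ↦ ‖h₁ x‖ ^ 2) = fun x ↦ ‖(c : ℂ)‖ ^ 2 * ‖h x‖ ^ 2 := by
        funext x
        simp only [hh₁, norm_mul, mul_pow]
      rw [e, integral_const_mul, hc2, ← hN, inv_mul_cancel₀ hpos.ne']
    have hle : B ≤ tableDirichletEnergy a w h₁ := csInf_le hTbdd ⟨h₁, hh₁t, hh₁s, hn₁, rfl⟩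
    rw [hh₁, tableDirichletEnergy_const_mul, hc2] at hle
    calc B * N ≤ N⁻¹ * tableDirichletEnergy a w h * N := mul_le_mul_of_nonneg_right hle hN0
      _ = tableDirichletEnergy a w h := by field_simp
  -- density: `B ∫|v|² ≤ 𝓔^w_a(v)` on the finite-energy class, hence `B ≤ coreBottom`
  have hBcore : B ≤ coreBottom w a := by
    refine le_csInf (coreSet_nonempty w ha) ?_
    rintro _ ⟨f, hf, hn, rfl⟩
    have := table_bottom_mul_le_of_finiteEnergy hw ha hBtest hf.1 hf.2.1 hf.2.2
    rwa [hn, mul_one] at this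
  have hBeq : coreBottom w a = B := le_antisymm hcoreB hBcore
  refine ⟨?_, hBeq⟩
  -- a minimising sequence of window tests
  obtain ⟨x, -, hx, hmem⟩ := exists_seq_tendsto_sInf hTne hTbdd
  have hmem' : ∀ n, ∃ h : ℝ → ℂ, IsWeilTest h ∧ tsupport h ⊆ Icc (-a) a ∧
      ∫ t : ℝ, ‖h t‖ ^ 2 = 1 ∧ x n = tableDirichletEnergy a w h := hmem
  choose g hg hsupp hnorm hxg using hmem'
  have hEg : Tendsto (fun n ↦ tableDirichletEnergy a w (g n)) atTop (𝓝 B) := by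
    have hfun : (fun n ↦ tableDirichletEnergy a w (g n)) = x := funext fun n ↦ (hxg n).symm
    rw [hfun]
    exact hx
  -- `Re Q_ζ` is bounded along it
  have hbdd : BddAbove (Set.range fun n ↦ (weilQuadratic (g n)).re) := by
    obtain ⟨B', hB'⟩ := hEg.bddAbove_range
    refine ⟨4 * a * Real.exp (2 * a) + 4 * (∑ n ∈ weilPrimeIndex a, (Λ n : ℝ) / Real.sqrt n) +
      B' - weilMarkovConstant a, ?_⟩
    rintro _ ⟨n, rfl⟩
    simp only
    rw [weilQuadratic_re_eq_weilPoleForm_add_weilDirichletEnergy_sub (hg n) (hsupp n), hnorm n,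
      mul_one]
    have h1 : tableDirichletEnergy a w (g n) ≤ B' := hB' ⟨n, rfl⟩
    have h2 := weilPoleForm_le_of_sphere ha (hg n) (hsupp n) (hnorm n)
    have h3 := weilDirichletEnergy_le_of_table hw (hg n).memLp_two (a := a)
    rw [hnorm n, mul_one] at h3
    linarith
  -- compactness
  obtain ⟨u, hu, φ, hφ, hlim⟩ := ConnesConsaniMoscovici2025_thm_3_6_holds a ha g
    (fun n ↦ ⟨hg n, hsupp n, hnorm n⟩) hbdd
  have hgm : ∀ n, MemLp (g (φ n)) 2 := fun n ↦ (hg (φ n)).memLp_two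
  have hus : ∀ᵐ x : ℝ, x ∉ Icc (-a) a → u x = 0 :=
    ae_eq_zero_of_tendsto hu hgm (fun n x hx ↦
      image_eq_zero_of_notMem_tsupport fun h' ↦ hx (hsupp (φ n) h')) hlim
  have hun : ∫ x, ‖u x‖ ^ 2 = 1 := by
    have h1 := tendsto_integral_norm_sq hu hgm hlim
    simp only [hnorm] at h1
    exact (tendsto_nhds_unique tendsto_const_nhds h1).symm
  obtain ⟨hufin, huE⟩ := table_finiteEnergy_of_tendsto (fun n ↦ hg (φ n)) hu hlim
    (hEg.comp hφ.tendsto_atTop)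
  -- a pointwise-supported representative
  set v₀ : ℝ → ℂ := (Icc (-a) a).indicator (hu.1.mk u) with hv₀def
  have hv₀u : v₀ =ᵐ[volume] u := by
    filter_upwards [hu.1.ae_eq_mk, hus] with y h1 h2
    by_cases hy : y ∈ Icc (-a) a
    · rw [hv₀def, indicator_of_mem hy]; exact h1.symm
    · rw [hv₀def, indicator_of_notMem hy, h2 hy]
  have hv₀ : coreAdm a v₀ := by
    refine ⟨hu.ae_eq hv₀u.symm, fun y hy ↦ indicator_of_notMem hy _, ?_⟩
    rw [weilIncrement_congr_ae hv₀u]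
    exact hufin
  have hv₀n : ∫ y, ‖v₀ y‖ ^ 2 = 1 := by
    rw [← hun]; exact integral_congr_ae (hv₀u.mono fun y hy ↦ by simp [hy])
  refine ⟨v₀, hv₀, hv₀n, le_antisymm ?_ (coreBottom_le hw hv₀ hv₀n)⟩
  rw [tableDirichletEnergy_congr_ae a w hv₀u, hBeq]
  exact huE

/-- **Existence of a core ground state** for every non-negative table at every window `a > 0`.
[cite: ConnesConsaniMoscovici2025, Thm 3.6] -/
theorem exists_isCoreGround {a : ℝ} {w : ℕ → ℝ} (hw : ∀ n ∈ weilPrimeIndex a, 0 ≤ w n)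
    (ha : 0 < a) : ∃ u : ℝ → ℂ, IsCoreGround w a u :=
  (exists_isCoreGround_and_coreBottom_eq hw ha).1

/-- **The core bottom is the infimum of `𝓔^w_a` over normalised window test functions** (window
tests are a form core). [cite: FukushimaOshimaTakeda2011, §1.4 Example 1.4.1] -/
theorem coreBottom_eq_sInf_isWeilTest {a : ℝ} {w : ℕ → ℝ} (hw : ∀ n ∈ weilPrimeIndex a, 0 ≤ w n)
    (ha : 0 < a) :
    coreBottom w a = sInf {x : ℝ | ∃ h : ℝ → ℂ, IsWeilTest h ∧ tsupport h ⊆ Icc (-a) a ∧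
      ∫ t, ‖h t‖ ^ 2 = (1 : ℝ) ∧ x = tableDirichletEnergy a w h} :=
  (exists_isCoreGround_and_coreBottom_eq hw ha).2

/-! ## Dictionary to the campaign's continuum datum -/

/-- **The core is the pole-free part of the windowed form of the datum `tableDatum w`**: for a
window test function `g` (`tsupport g ⊆ [-a, a]`),
`coreForm a w g = Re Q_{tableDatum w}(g) − P(g)` with `P = weilPoleForm` the polar (rank ≤ 2) term
— the Markov-form-side typing of the class 'pole-free windowed forms of non-negative tables'
(`tableClosedForm_eq_re_quadratic` composed with `coreForm_eq`). [cite: Bombieri2000Weil, Thm 2 (p. 193)] -/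
theorem coreForm_eq_re_quadratic_sub (a : ℝ) (w : ℕ → ℝ) {g : ℝ → ℂ} (hg : IsWeilTest g)
    (hgs : tsupport g ⊆ Icc (-a) a) :
    coreForm a w g = ((tableDatum w).quadratic g).re - weilPoleForm g := by
  have h := tableClosedForm_eq_re_quadratic w hg hgs
  rw [coreForm_eq] at h
  linarith

/-- For ζ's table the dictionary reads `coreForm a zetaTable g = Re Q_ζ(g) − P(g)` on window tests
(`weilQuadratic`). [cite: Bombieri2000Weil, Thm 2 (p. 193)] -/
theorem coreForm_zetaTable_eq (a : ℝ) {g : ℝ → ℂ} (hg : IsWeilTest g) (hgs : tsupport g ⊆ Icc (-a) a) :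
    coreForm a zetaTable g = (weilQuadratic g).re - weilPoleForm g := by
  have h := weilQuadratic_re_eq_weilPoleForm_add_weilDirichletEnergy_sub hg hgs
  unfold coreForm
  rw [tableDirichletEnergy_zetaTable, tableMarkovConstant_zetaTable]
  linarith

end Summit.RiemannHypothesis.RiemannHypothesis.Theorems.PfPersistence

end
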